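import Summits.ValiantsHypothesis.ValiantsHypothesis.Theses.DefinabilityGap

/-!
# `DefinabilityGap.Assembly` holds (bookkeeping item 23548 closed by proof)

The assembly item of route `DefinabilityGap` (decomp-valiant workshop, lens 5) is the implication
`KIPlantedHitting → KIAnnihilatorDefinableOnCollapse → ValiantsHypothesis` (K1 → K2c → VP_ℂ ≠ VNP_ℂ),
which is literally the route's certified deciding theorem `closes` (D-0027 §2.1). It is closed here so
that no decorative item remains open on the route (workshop critic, bus 527, 2026-08-30T07:57:31Z,
principle (i)); the route's open content is unchanged: the declared residual K1 (`KIPlantedHitting`,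
split into `KIPlantedHittingWs` + `CollapseToVPws`), the attacked conjunct K2c
(`KIAnnihilatorDefinableOnCollapse`, split at the CH cut) and the record asides. No tag, no rung changes.
-/

set_option linter.dupNamespace false

namespace Summit.ValiantsHypothesis.ValiantsHypothesis.Theorems.DefinabilityGapAssembly

/-- **Item 23548 (`DefinabilityGap.Assembly`) holds**: `K1 → K2c → VP_ℂ ≠ VNP_ℂ` is the route's deciding
theorem `closes` (if `VP = VNP`, K2c supplies a CH/poly-definable, hence — by the collapse — VNP = VP
annihilator family of the KI-planted permanent map, which K1 says is hit: contradiction).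
[cite: KabanetsImpagliazzo2003, Thm. 7.7; Burgisser2000, Cor. 4.3] -/
theorem assembly_holds :
    Summit.ValiantsHypothesis.ValiantsHypothesis.Theses.DefinabilityGap.Assembly :=
  fun h₁ h₂ => Summit.ValiantsHypothesis.ValiantsHypothesis.Theses.DefinabilityGap.closes h₁ h₂

end Summit.ValiantsHypothesis.ValiantsHypothesis.Theorems.DefinabilityGapAssembly
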